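import Literature.AlgebraicGeometry.Motives.AbelianVarietyKernelComponent
import HarnessLib

/-!
# The identity component of a closed subgroup of an abelian variety (over `K = K̄`)

Let `X` be an abelian variety over an algebraically closed field `K` and `N ⊆ X` a closed subset
whose `K`-points form a subgroup of `X(K)` (closed under products and inverses; e.g. the kernel set
of a homomorphism, or — granted the seesaw theorem — `K(L) = {x : t_x^* L ≅ L}` and the "orthogonal"
`{x : (t_x^* L ⊗ L⁻¹)|_Y trivial}` of an abelian subvariety `Y` in Poincaré's reducibility theorem).
This file proves the classical structure statements for such `N` (Mumford, *Abelian Varieties*,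
§4 and §19 p. 173; Milne 1986, §12, proof of Prop. 12.1: "the reduced subscheme of the zero
component … is an abelian variety"; Görtz–Wedhorn II, (27.1)–(27.3) on components of group schemes),
with the identity component realised by `Motives/AbelianVarietyKernelComponent.redSub`:

* `SchemeOver.range_subset_of_forall_algPoints` — **closed conditions are checked on `K`-points**:
  for a `K`-scheme `W` of finite type, a morphism `m : W → S` and a closed `N ⊆ S`, if `m(w) ∈ N`
  for all `K`-points `w` then `m(W) ⊆ N` (closed points are `K`-rational — Mathlib
  `pointOfClosedPoint`, Nullstellensatz — and dense — Mathlib `LocallyOfFiniteType.jacobsonSpace`);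
* `translation_apply_mem` — translations by `K`-points of `N` preserve `N`;
* `exists_maximal_irreducible_origin_mem` — a maximal irreducible subset `C ∋ e` of `N` exists and is
  closed; `subset_of_isPreirreducible_of_origin_mem` — it is **unique**: every irreducible `Z ∋ e`
  inside `N` lies in `C` (`C · Z` is irreducible, lies in `N`, contains `C` and `Z`);
  `range_divMor_subset_of_maximal'` — `C` is stable under `δ(x, y) = x y⁻¹`, so
  `redSub C … : AbelianVariety K` (the **identity component** `(N_red)⁰`) is defined, with its
  closed-immersion homomorphism `redSubHom` into `X`;
* `subset_image_translation_of_isPreirreducible`, `exists_finite_subset_iUnion_translation` — every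
  irreducible subset of `N` lies in the translate `t_Q(C)` by any of its `K`-points `Q`, and **`N` is
  a finite union of translates `t_{Qᵢ}(C)`, `Qᵢ ∈ N(K)`** (`X` is noetherian: `N` is a finite union of
  irreducible closed subsets, each with a closed point).

Everything is proved; no named facts. Mathlib searched (pin): `pointOfClosedPoint` (+ `_comp`,
`_apply`), `LocallyOfFiniteType.jacobsonSpace`, `closure_closedPoints`,
`NoetherianSpace.exists_finite_set_isClosed_irreducible`, `IsClosed.exists_closed_singleton` (used).
In this tree (used): `redSubOver`/`redSubι`/`redSubOne`/`divMor`/`exists_maximal_isPreirreducible_subset`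
(`Motives/AbelianVarietyKernelComponent`), `AbelianVariety.translation`/`comp_translation`/
`translation_inv_comp_translation`/`pointOfClosed` (`Motives/AbelianVarietyTranslation`).

## References

* D. Mumford, *Abelian Varieties*, TIFR Studies in Mathematics 5, OUP (1970): §19, proof of Thm. 1
  (p. 173: connected components of closed subgroups). [MumfordAV1970]
* J. S. Milne, *Abelian Varieties*, in: Cornell–Silverman (eds.), *Arithmetic Geometry*, Springer
  (1986): §12, Prop. 12.1 and its proof (held copy, PDF p. 189). [Milne1986AbelianVarieties]
* U. Görtz, T. Wedhorn, *Algebraic Geometry II*, Springer Spektrum (2023): (27.1)–(27.3).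
  [GortzWedhorn2023]
-/

universe u

open CategoryTheory CategoryTheory.Limits AlgebraicGeometry MonoidalCategory CartesianMonoidalCategory
open TopologicalSpace Topology

noncomputable section

namespace Literature.AlgebraicGeometry.Motives

open scoped MonObj
open Scheme.IdealSheafData

/-! ### `K`-points are dense: closed conditions are checked on `K`-points -/

section Density

variable {K : Type u} [Field K] [IsAlgClosed K]

/-- **Over an algebraically closed field, a closed condition holds on a `K`-scheme of finite type as
soon as it holds at all `K`-points**: if `m : W → S` is a morphism and `N ⊆ S` is closed with
`m(w) ∈ N` for every `K`-point `w` of `W`, then `m(W) ⊆ N` (the closed points of `W` are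
`K`-rational, Hilbert's Nullstellensatz, Mathlib `pointOfClosedPoint`, and dense in `W`, Mathlib
`LocallyOfFiniteType.jacobsonSpace`). [folklore] -/
theorem SchemeOver.range_subset_of_forall_algPoints {W : SchemeOver K} [LocallyOfFiniteType W.hom]
    {S : Scheme.{u}} (m : W.left ⟶ S) {N : Set S} (hN : IsClosed N)
    (h : ∀ R : AlgPoints W K, m (R.left (IsLocalRing.closedPoint K)) ∈ N) : Set.range m ⊆ N := by
  haveI : JacobsonSpace W.left := LocallyOfFiniteType.jacobsonSpace W.hom
  have hS : IsClosed (m ⁻¹' N) := hN.preimage m.continuous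
  have hcl : closedPoints W.left ⊆ m ⁻¹' N := fun w hw => by
    let R : AlgPoints W K := AlgPoints.mk (pointOfClosedPoint W.hom w hw)
      (by rw [pointOfClosedPoint_comp, Algebra.algebraMap_self, CommRingCat.ofHom_id, Spec.map_id])
    have hR : R.left (IsLocalRing.closedPoint K) = w := pointOfClosedPoint_apply W.hom w hw _
    have := h R
    rwa [hR] at this
  rintro _ ⟨w, rfl⟩
  have hw : w ∈ closure (closedPoints W.left) := by rw [closure_closedPoints]; trivial
  exact closure_minimal hcl hS hw

end Density

namespace AbelianVariety

variable {K : Type u} [Field K]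

/-! ### The identity component of a closed subset whose `K`-points form a subgroup -/

section IdentityComponent

variable {X : AbelianVariety K} {N : Set X.X.left} (hN : IsClosed N)

/-- The point of `P ≫ ι_C` for a `T`-valued point `P` of `X_C` lies on `C`. [folklore] -/
theorem comp_redSubι_left_apply_mem (C : Closeds X.X.left) {T : SchemeOver K} (R : T ⟶ redSubOver C)
    (t : T.left) : (R ≫ redSubι C).left t ∈ (C : Set X.X.left) := by
  rw [Over.comp_left, Scheme.Hom.comp_apply, ← range_redSubι_left C]
  exact ⟨_, rfl⟩

include hN in
/-- A maximal irreducible subset of the closed set `N` containing the origin exists and is closed.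
[folklore] -/
theorem exists_maximal_irreducible_origin_mem (h1 : origin X ∈ N) :
    ∃ C : Closeds X.X.left, IsIrreducible (C : Set X.X.left) ∧ origin X ∈ C ∧
      (C : Set X.X.left) ⊆ N ∧
      ∀ Z : Set X.X.left, IsPreirreducible Z → (C : Set X.X.left) ⊆ Z → Z ⊆ N → Z = C := by
  obtain ⟨C, hCirr, hDC, hCN, hmax⟩ := exists_maximal_isPreirreducible_subset
    (isPreirreducible_singleton (x := origin X)) (Set.singleton_subset_iff.2 h1)
  have hCcl : IsClosed C := by
    rw [← closure_eq_iff_isClosed]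
    exact hmax _ hCirr.closure subset_closure (closure_minimal hCN hN)
  exact ⟨⟨C, hCcl⟩, ⟨⟨origin X, hDC rfl⟩, hCirr⟩, hDC rfl, hCN, hmax⟩

variable [IsAlgClosed K]
  (hNmul : ∀ P Q : X.Points K, P.left (IsLocalRing.closedPoint K) ∈ N →
    Q.left (IsLocalRing.closedPoint K) ∈ N → (P * Q).left (IsLocalRing.closedPoint K) ∈ N)
  (hNinv : ∀ P : X.Points K, P.left (IsLocalRing.closedPoint K) ∈ N →
    P⁻¹.left (IsLocalRing.closedPoint K) ∈ N)

include hN hNmul in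
/-- For closed `C, C' ⊆ N`, the product morphism `X_C × X_{C'} → X`, `(x, y) ↦ x y`, has
image in `N` (checked on `K`-points, `N(K)` being closed under products). [folklore] -/
theorem range_mul_redSubι_subset (C C' : Closeds X.X.left) (hCN : (C : Set X.X.left) ⊆ N)
    (hC'N : (C' : Set X.X.left) ⊆ N) :
    Set.range ((redSubι C ⊗ₘ redSubι C') ≫ μ[X.X]).left ⊆ N := by
  refine SchemeOver.range_subset_of_forall_algPoints _ hN fun R => ?_
  have e : R ≫ (redSubι C ⊗ₘ redSubι C') ≫ μ[X.X] =
      (R ≫ CartesianMonoidalCategory.fst _ _ ≫ redSubι C) *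
        (R ≫ CartesianMonoidalCategory.snd _ _ ≫ redSubι C') := by
    rw [← CartesianMonoidalCategory.lift_fst_comp_snd_comp, ← Hom.mul_def, MonObj.comp_mul]
  have h2 : ((redSubι C ⊗ₘ redSubι C') ≫ μ[X.X]).left (R.left (IsLocalRing.closedPoint K)) =
      (R ≫ (redSubι C ⊗ₘ redSubι C') ≫ μ[X.X]).left (IsLocalRing.closedPoint K) := by
    simp only [Over.comp_left, Scheme.Hom.comp_apply]
  rw [h2, e]
  refine hNmul _ _ (hCN ?_) (hC'N ?_)
  · rw [← Category.assoc]; exact comp_redSubι_left_apply_mem C _ _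
  · rw [← Category.assoc]; exact comp_redSubι_left_apply_mem C' _ _

include hN hNmul hNinv in
/-- For a closed `C ⊆ N`, the difference morphism `X_C × X_C → X`, `(x, y) ↦ x y⁻¹`, has
image in `N`. [folklore] -/
theorem range_divMor_redSubι_subset (C : Closeds X.X.left) (hCN : (C : Set X.X.left) ⊆ N) :
    Set.range ((redSubι C ⊗ₘ redSubι C) ≫ divMor X).left ⊆ N := by
  refine SchemeOver.range_subset_of_forall_algPoints _ hN fun R => ?_
  have e : R ≫ (redSubι C ⊗ₘ redSubι C) ≫ divMor X =
      (R ≫ CartesianMonoidalCategory.fst _ _ ≫ redSubι C) *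
        (R ≫ CartesianMonoidalCategory.snd _ _ ≫ redSubι C)⁻¹ := by
    unfold divMor
    rw [MonObj.comp_mul, GrpObj.comp_inv, ← Category.assoc, ← Category.assoc,
      CartesianMonoidalCategory.tensorHom_fst, CartesianMonoidalCategory.tensorHom_snd,
      Category.assoc, Category.assoc, MonObj.comp_mul, GrpObj.comp_inv]
  have h2 : ((redSubι C ⊗ₘ redSubι C) ≫ divMor X).left (R.left (IsLocalRing.closedPoint K)) =
      (R ≫ (redSubι C ⊗ₘ redSubι C) ≫ divMor X).left (IsLocalRing.closedPoint K) := by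
    simp only [Over.comp_left, Scheme.Hom.comp_apply]
  rw [h2, e]
  refine hNmul _ _ (hCN ?_) (hNinv _ (hCN ?_))
  · rw [← Category.assoc]; exact comp_redSubι_left_apply_mem C _ _
  · rw [← Category.assoc]; exact comp_redSubι_left_apply_mem C _ _

include hN hNmul in
/-- **Translations by `K`-points of `N` preserve `N`** (on `K`-points this is closure under
products; `K`-points are dense in the reduced subscheme `X_N`). [folklore] -/
theorem translation_apply_mem (Q : X.Points K) (hQ : Q.left (IsLocalRing.closedPoint K) ∈ N)
    {x : X.X.left} (hx : x ∈ N) : (X.translation Q).left x ∈ N := by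
  let Nc : Closeds X.X.left := ⟨N, hN⟩
  have key : Set.range ((redSubι Nc).left ≫ (X.translation Q).left) ⊆ N := by
    refine SchemeOver.range_subset_of_forall_algPoints (W := redSubOver Nc) _ hN fun R => ?_
    have e : (R ≫ redSubι Nc) ≫ X.translation Q = Q * (R ≫ redSubι Nc) := comp_translation X _ Q
    have h2 : ((redSubι Nc).left ≫ (X.translation Q).left) (R.left (IsLocalRing.closedPoint K)) =
        ((R ≫ redSubι Nc) ≫ X.translation Q).left (IsLocalRing.closedPoint K) := by
      rw [Over.comp_left, Over.comp_left, Scheme.Hom.comp_apply, Scheme.Hom.comp_apply,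
        Scheme.Hom.comp_apply]
    rw [h2, e]
    exact hNmul _ _ hQ (comp_redSubι_left_apply_mem Nc R _)
  have hx' : x ∈ Set.range (redSubι Nc).left := by rw [range_redSubι_left]; exact hx
  obtain ⟨b, rfl⟩ := hx'
  exact key ⟨b, rfl⟩

include hN hNmul in
/-- **Uniqueness of the identity component.** If `C ∋ e` is a maximal irreducible subset of `N`,
every irreducible subset `Z ∋ e` of `N` lies in `C`: `C · Z` is irreducible, lies in `N` and
contains `C` and `Z`. [folklore] -/
theorem subset_of_isPreirreducible_of_origin_mem (C : Closeds X.X.left)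
    (hC : IsIrreducible (C : Set X.X.left)) (h1 : origin X ∈ C) (hCN : (C : Set X.X.left) ⊆ N)
    (hmax : ∀ Z : Set X.X.left, IsPreirreducible Z → (C : Set X.X.left) ⊆ Z → Z ⊆ N → Z = C)
    {Z : Set X.X.left} (hZ : IsPreirreducible Z) (h1Z : origin X ∈ Z) (hZN : Z ⊆ N) :
    Z ⊆ C := by
  -- enlarge `Z` to a maximal, hence closed, irreducible subset `Z'` of `N`
  obtain ⟨Z', hZ'irr, hZZ', hZ'N, hZ'max⟩ := exists_maximal_isPreirreducible_subset hZ hZN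
  have hZ'cl : IsClosed Z' := by
    rw [← closure_eq_iff_isClosed]
    exact hZ'max _ hZ'irr.closure subset_closure (closure_minimal hZ'N hN)
  let Zc : Closeds X.X.left := ⟨Z', hZ'cl⟩
  have hZc : IsIrreducible (Zc : Set X.X.left) := ⟨⟨origin X, hZZ' h1Z⟩, hZ'irr⟩
  have h1' : origin X ∈ Zc := hZZ' h1Z
  haveI := geometricallyIntegral_redSubOver_hom C hC
  haveI := geometricallyIntegral_redSubOver_hom Zc hZc
  haveI : IsIntegral (redSubOver C ⊗ redSubOver Zc).left := SchemeOver.isIntegral_left _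
  set m := (redSubι C ⊗ₘ redSubι Zc) ≫ μ[X.X] with hm
  have hmN : Set.range m.left ⊆ N := range_mul_redSubι_subset hN hNmul C Zc hCN hZ'N
  have hm' : m = (CartesianMonoidalCategory.fst _ _ ≫ redSubι C) *
      (CartesianMonoidalCategory.snd _ _ ≫ redSubι Zc) := by
    rw [hm, ← CartesianMonoidalCategory.lift_fst_comp_snd_comp, ← Hom.mul_def]
  -- `C ⊆ range m` via `c ↦ (c, e)` and `Z' ⊆ range m` via `z ↦ (e, z)`
  have hCm : (C : Set X.X.left) ⊆ Set.range m.left := by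
    intro x hx
    rw [← range_redSubι_left C] at hx
    obtain ⟨b, rfl⟩ := hx
    let s : redSubOver C ⟶ redSubOver C ⊗ redSubOver Zc :=
      CartesianMonoidalCategory.lift (𝟙 _) (CartesianMonoidalCategory.toUnit _ ≫ redSubOne Zc h1')
    have hs : s ≫ m = redSubι C := by
      rw [hm', MonObj.comp_mul, CartesianMonoidalCategory.lift_fst_assoc, Category.id_comp,
        CartesianMonoidalCategory.lift_snd_assoc, Category.assoc, redSubOne_ι, ← Hom.one_def, mul_one]
    refine ⟨s.left b, ?_⟩
    rw [← Scheme.Hom.comp_apply]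
    have e : s.left ≫ m.left = (redSubι C).left := congrArg CommaMorphism.left hs
    rw [e]
  have hZm : Z' ⊆ Set.range m.left := by
    intro x hx
    have hx' : x ∈ Set.range (redSubι Zc).left := by rw [range_redSubι_left]; exact hx
    obtain ⟨b, rfl⟩ := hx'
    let s : redSubOver Zc ⟶ redSubOver C ⊗ redSubOver Zc :=
      CartesianMonoidalCategory.lift (CartesianMonoidalCategory.toUnit _ ≫ redSubOne C h1) (𝟙 _)
    have hs : s ≫ m = redSubι Zc := by
      rw [hm', MonObj.comp_mul, CartesianMonoidalCategory.lift_fst_assoc,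
        CartesianMonoidalCategory.lift_snd_assoc, Category.id_comp, Category.assoc, redSubOne_ι,
        ← Hom.one_def, one_mul]
    refine ⟨s.left b, ?_⟩
    rw [← Scheme.Hom.comp_apply]
    have e : s.left ≫ m.left = (redSubι Zc).left := congrArg CommaMorphism.left hs
    rw [e]
  have hirr : IsPreirreducible (closure (Set.range m.left)) := by
    refine IsPreirreducible.closure ?_
    rw [← Set.image_univ]
    exact ((IrreducibleSpace.isIrreducible_univ _).image _ m.left.continuous.continuousOn).isPreirreducible
  have hmax' : closure (Set.range m.left) = C :=
    hmax _ hirr (hCm.trans subset_closure) (closure_minimal hmN hN)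
  exact hZZ'.trans (hZm.trans (subset_closure.trans hmax'.le))

include hN hNmul hNinv in
/-- A maximal irreducible subset `C ∋ e` of `N` is stable under the difference morphism:
`δ(X_C × X_C) ⊆ C`. [folklore] -/
theorem range_divMor_subset_of_maximal' (C : Closeds X.X.left) (hC : IsIrreducible (C : Set X.X.left))
    (h1 : origin X ∈ C) (hCN : (C : Set X.X.left) ⊆ N)
    (hmax : ∀ Z : Set X.X.left, IsPreirreducible Z → (C : Set X.X.left) ⊆ Z → Z ⊆ N → Z = C) :
    Set.range ((redSubι C ⊗ₘ redSubι C) ≫ divMor X).left ⊆ C := by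
  haveI := geometricallyIntegral_redSubOver_hom C hC
  haveI : IsIntegral (redSubOver C ⊗ redSubOver C).left := SchemeOver.isIntegral_left _
  set m := (redSubι C ⊗ₘ redSubι C) ≫ divMor X with hm
  have hmN : Set.range m.left ⊆ N := range_divMor_redSubι_subset hN hNmul hNinv C hCN
  have hCm : (C : Set X.X.left) ⊆ Set.range m.left := by
    intro x hx
    rw [← range_redSubι_left C] at hx
    obtain ⟨b, rfl⟩ := hx
    let s : redSubOver C ⟶ redSubOver C ⊗ redSubOver C :=
      CartesianMonoidalCategory.lift (𝟙 _) (CartesianMonoidalCategory.toUnit _ ≫ redSubOne C h1)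
    have hs : s ≫ m = redSubι C := by
      rw [hm]
      unfold divMor
      rw [CartesianMonoidalCategory.lift_map_assoc, Category.id_comp, Category.assoc, redSubOne_ι,
        MonObj.comp_mul, GrpObj.comp_inv, CartesianMonoidalCategory.lift_fst,
        CartesianMonoidalCategory.lift_snd, ← Hom.one_def, inv_one, mul_one]
    refine ⟨s.left b, ?_⟩
    rw [← Scheme.Hom.comp_apply]
    have e : s.left ≫ m.left = (redSubι C).left := congrArg CommaMorphism.left hs
    rw [e]
  have hirr : IsPreirreducible (closure (Set.range m.left)) := by
    refine IsPreirreducible.closure ?_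
    rw [← Set.image_univ]
    exact ((IrreducibleSpace.isIrreducible_univ _).image _ m.left.continuous.continuousOn).isPreirreducible
  have hmax' : closure (Set.range m.left) = C :=
    hmax _ hirr (hCm.trans subset_closure) (closure_minimal hmN hN)
  exact subset_closure.trans hmax'.le

include hN hNmul hNinv in
/-- **Every irreducible subset of `N` lies in a translate of the identity component** by any of
its `K`-points. [folklore] -/
theorem subset_image_translation_of_isPreirreducible (C : Closeds X.X.left)
    (hC : IsIrreducible (C : Set X.X.left)) (h1 : origin X ∈ C) (hCN : (C : Set X.X.left) ⊆ N)
    (hmax : ∀ Z : Set X.X.left, IsPreirreducible Z → (C : Set X.X.left) ⊆ Z → Z ⊆ N → Z = C)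
    {Z : Set X.X.left} (hZ : IsPreirreducible Z) (hZN : Z ⊆ N) (Q : X.Points K)
    (hQZ : Q.left (IsLocalRing.closedPoint K) ∈ Z) :
    Z ⊆ (X.translation Q).left '' C := by
  have hQN : Q.left (IsLocalRing.closedPoint K) ∈ N := hZN hQZ
  have hQ'N := hNinv Q hQN
  set t := X.translation Q⁻¹ with ht
  have hD : IsPreirreducible (t.left '' Z) := hZ.image _ t.left.continuous.continuousOn
  have hDN : t.left '' Z ⊆ N := by
    rintro _ ⟨z, hz, rfl⟩
    exact translation_apply_mem hN hNmul Q⁻¹ hQ'N (hZN hz)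
  have h1D : origin X ∈ t.left '' Z := by
    refine ⟨_, hQZ, ?_⟩
    rw [← Scheme.Hom.comp_apply]
    change (Q ≫ t).left (IsLocalRing.closedPoint K) = origin X
    rw [ht, comp_translation, inv_mul_cancel, one_left]
    change (unitPt X) ((specOver K K).hom (IsLocalRing.closedPoint K)) = origin X
    rw [eq_specPt K ((specOver K K).hom (IsLocalRing.closedPoint K))]
  have hDC : t.left '' Z ⊆ C :=
    subset_of_isPreirreducible_of_origin_mem hN hNmul C hC h1 hCN hmax hD h1D hDN
  intro z hz
  refine ⟨t.left z, hDC ⟨z, hz, rfl⟩, ?_⟩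
  rw [← Scheme.Hom.comp_apply]
  change (t ≫ X.translation Q).left z = z
  rw [ht, translation_inv_comp_translation]
  rfl

include hN hNmul hNinv in
/-- **`N` is a finite union of translates of the identity component** by `K`-points of `N` (`N` is
a finite union of irreducible closed subsets, each of which has a closed, hence rational, point
and lies in the corresponding translate). [folklore] -/
theorem exists_finite_subset_iUnion_translation (C : Closeds X.X.left)
    (hC : IsIrreducible (C : Set X.X.left)) (h1 : origin X ∈ C) (hCN : (C : Set X.X.left) ⊆ N)
    (hmax : ∀ Z : Set X.X.left, IsPreirreducible Z → (C : Set X.X.left) ⊆ Z → Z ⊆ N → Z = C) :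
    ∃ (I : Type u) (_ : Finite I) (Q : I → X.Points K),
      (∀ i, (Q i).left (IsLocalRing.closedPoint K) ∈ N) ∧
      N ⊆ ⋃ i, (X.translation (Q i)).left '' C := by
  haveI := isNoetherian_left X
  obtain ⟨S, hSf, hSc, hSi, hNS⟩ := NoetherianSpace.exists_finite_set_isClosed_irreducible hN
  have key : ∀ t ∈ S, ∃ Q : X.Points K, Q.left (IsLocalRing.closedPoint K) ∈ t := fun t ht => by
    obtain ⟨x, hxt, hx⟩ := (hSc t ht).exists_closed_singleton (hSi t ht).nonempty
    refine ⟨X.pointOfClosed x hx, ?_⟩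
    have e : (X.pointOfClosed x hx).left (IsLocalRing.closedPoint K) = x := X.pt_pointOfClosed x hx
    rw [e]; exact hxt
  choose Q hQ using key
  have htN : ∀ t ∈ S, t ⊆ N := fun t ht => hNS ▸ Set.subset_sUnion_of_mem ht
  refine ⟨↥S, hSf.to_subtype, fun i => Q i.1 i.2, fun i => htN i.1 i.2 (hQ i.1 i.2), ?_⟩
  rw [hNS]
  refine Set.sUnion_subset fun t ht => ?_
  exact (subset_image_translation_of_isPreirreducible hN hNmul hNinv C hC h1 hCN hmax
    (hSi t ht).isPreirreducible (htN t ht) (Q t ht) (hQ t ht)).trans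
    (Set.subset_iUnion (fun i : ↥S => (X.translation (Q i.1 i.2)).left '' (C : Set X.X.left)) ⟨t, ht⟩)

end IdentityComponent

end AbelianVariety

end Literature.AlgebraicGeometry.Motives
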